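import Mathlib
import Summits.CriticalPhenomena.CardyFormulaZ2.Theorems.CardySelfRefinementGradientComparabilityStubDrhoEqSignedSum
import Summits.CriticalPhenomena.CardyFormulaZ2.Theorems.CardySelfRefinementGradientComparabilityStubSlopeBoundsBundle
import HarnessLib

/-!
# Slope bounds, Stage A: `|∂ρP| ≤ 2^k/(1-ρ) · Σ_{axial window edges} M_k(ρ,c)(e pivotal)`

Crux `stmt-CriticalPhenomena-10269`
(`Summit.CriticalPhenomena.CardyFormulaZ2.Theses.CardySelfRefinement.GradientComparability`),
line `monotone-product-coordinates`, helper file of the stub `stub_slopeBounds` (first-order slope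
bounds).  Vocabulary (`ax tb opn cfg prm M Aloc window coinWindow edgeOf Dρ`) from
`CardySelfRefinementDefs`; the bundle combinatorics from `…StubSlopeBoundsBundle`.

## Mathematics

By the signed Russo dictionary (`stub_Drho_eq_signed_sum`), for `η ≠ 0` and `ρ ∈ [0,1]`,
`∂ρP(ρ,c) = Σ_{selectors σ of the coin window} (P(E | σ on) − P(E | σ off))`,
`E = cfg k ⁻¹' Aloc m F η`, under the coin law `prodBernoulli (prm k ρ c)`.  Each summand is at most
`P(σ pivotal for E)` in absolute value (`abs_real_insert_sub_sdiff_le`).  A pivotal selector of the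
bundle `(t, d)` forces, for some `j < k`, the own coin of the sub-edge `(w j, d)` to be pivotal at
the sample with the selector off and the own coins of the bundle reset to the chain pattern `J_j`
(`exists_isPivotal_own_of_isPivotal_selector`); that event ignores the selector and the `k` own
coins, so pinning them to "off / pattern `J_j`" costs the factor `(1-ρ) 2^{-k}` (independence of
disjoint coin sets, `prodBernoulli_real_inter_of_determinedBy`, and the cylinder weight
`prodBernoulli_real_localCylinder`), after which the sample is unchanged and the own coin — hence,
the selector being off, the edge `edgeOf (w j, d)` — is pivotal (`real_isPivotal_selector_le`):

`P(σ pivotal) ≤ 2^k/(1-ρ) · Σ_{j<k} M_k(ρ,c)(edgeOf (w j, d) pivotal for Aloc)`.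

Summing over the selectors of the coin window and re-indexing the sub-edges by the axial window
edges (sub-edges outside the window are never pivotal) gives the registered sub-goal
`Drho_abs_le_sum_axial_pivotal`: for `0 < k`, `η ≠ 0`, `δ > 0`, `ρ ∈ [0, 1-δ]` and every `c`,
`|∂ρP(ρ,c)| ≤ (2^k/δ) · Σ_{axial e ∈ window} M_k(ρ,c)(e pivotal for Aloc)`.
(Grimmett 1999, Thm. 2.25 / (2.32): Russo's formula and finite energy.)
-/

noncomputable section

namespace Summit.CriticalPhenomena.CardyFormulaZ2.Theorems.CardySelfRefinement

open scoped Topology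
open Filter Set MeasureTheory
open Literature.Probability.LatticeModels Literature.Probability.Percolation
open Literature.Probability.Percolation.QuadCrossing
open Summit.CriticalPhenomena.CardyFormulaZ2.Theses.CardySelfRefinement

/-! ## Two general facts -/

/-- The signed influence of a coordinate on a measurable event is at most the probability that the
coordinate is pivotal: `|ν{insert i ω ∈ B} − ν{ω ∖ {i} ∈ B}| ≤ ν{i pivotal for B}`. -/
theorem abs_real_insert_sub_sdiff_le {α : Type*} (ν : Measure (Set α)) [IsFiniteMeasure ν]
    {B : Set (Set α)} (hB : MeasurableSet B) (i : α) :
    |ν.real {ω | insert i ω ∈ B} - ν.real {ω | ω \ {i} ∈ B}| ≤ ν.real {ω | IsPivotal B i ω} := by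
  have hXm : MeasurableSet {ω : Set α | insert i ω ∈ B} := measurable_insert_pt i hB
  have hYm : MeasurableSet {ω : Set α | ω \ {i} ∈ B} := measurable_sdiff_pt i hB
  have h1 : ν.real {ω | insert i ω ∈ B} - ν.real {ω | ω \ {i} ∈ B} ≤ ν.real {ω | IsPivotal B i ω} := by
    rw [← measureReal_inter_add_sdiff (s := {ω : Set α | insert i ω ∈ B}) hYm]
    have ha : ν.real ({ω : Set α | insert i ω ∈ B} ∩ {ω | ω \ {i} ∈ B}) ≤ ν.real {ω | ω \ {i} ∈ B} :=
      measureReal_mono Set.inter_subset_right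
    have hb : ν.real ({ω : Set α | insert i ω ∈ B} \ {ω | ω \ {i} ∈ B}) ≤
        ν.real {ω | IsPivotal B i ω} :=
      measureReal_mono fun ω hω => Or.inl ⟨hω.1, hω.2⟩
    linarith
  have h2 : ν.real {ω | ω \ {i} ∈ B} - ν.real {ω | insert i ω ∈ B} ≤ ν.real {ω | IsPivotal B i ω} := by
    rw [← measureReal_inter_add_sdiff (s := {ω : Set α | ω \ {i} ∈ B}) hXm]
    have ha : ν.real ({ω : Set α | ω \ {i} ∈ B} ∩ {ω | insert i ω ∈ B}) ≤ ν.real {ω | insert i ω ∈ B} :=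
      measureReal_mono Set.inter_subset_right
    have hb : ν.real ({ω : Set α | ω \ {i} ∈ B} \ {ω | insert i ω ∈ B}) ≤
        ν.real {ω | IsPivotal B i ω} :=
      measureReal_mono fun ω hω => Or.inr ⟨hω.1, hω.2⟩
    linarith
  exact abs_sub_le_iff.2 ⟨h1, h2⟩

/-- An edge outside the window is never pivotal for the localised event `Aloc`. -/
theorem not_isPivotal_Aloc_of_notMem_window (m : ℕ) (F : Fin m → Quad (Set.univ : Set ℂ)) (η : ℝ)
    {e : Sym2 (Site 2)} (he : e ∉ window m F η) (ω : BondConfig (Site 2)) :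
    ¬ IsPivotal (Aloc m F η) e ω := by
  have h1 : insert e ω ∩ window m F η = ω ∩ window m F η := by
    ext x
    simp only [Set.mem_inter_iff, Set.mem_insert_iff, and_congr_left_iff, or_iff_right_iff_imp]
    rintro hx rfl
    exact absurd hx he
  have h2 : ω \ {e} ∩ window m F η = ω ∩ window m F η := by
    ext x
    simp only [Set.mem_inter_iff, Set.mem_sdiff, Set.mem_singleton_iff, and_congr_left_iff,
      and_iff_left_iff_imp]
    rintro hx - rfl
    exact he hx
  have hiff : insert e ω ∈ Aloc m F η ↔ ω \ {e} ∈ Aloc m F η := by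
    show insert e ω ∩ window m F η ∈ A m F η ↔ ω \ {e} ∩ window m F η ∈ A m F η
    rw [h1, h2]
  rintro (⟨ha, hb⟩ | ⟨ha, hb⟩)
  · exact hb (hiff.1 ha)
  · exact hb (hiff.2 ha)

/-! ## Charging a pivotal selector to the pivotal sub-edges of its bundle -/

/-- **The selector term is charged to the sub-edges.** For `ρ < 1` and the bundle `(t, d)` with
sub-edge enumeration `w`: `P(selector (t,d,2) pivotal for cfg k ⁻¹' Aloc) ≤
2^k/(1-ρ) · Σ_{j<k} M_k(ρ,c)(edgeOf (w j, d) pivotal for Aloc)`. -/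
theorem real_isPivotal_selector_le (k m : ℕ) (F : Fin m → Quad (Set.univ : Set ℂ)) {η : ℝ}
    (hη : η ≠ 0) {t : Site 2} {d : Fin 2} {w : ℕ → Site 2}
    (hw₁ : ∀ j, j < k → ax k (w j, d) ∧ tb k (w j, d) = t)
    (hw₂ : ∀ v : Site 2, ax k (v, d) → tb k (v, d) = t → ∃ j, j < k ∧ v = w j)
    (hw₃ : ∀ j j', j < k → j' < k → w j = w j' → j = j')
    {ρ : ℝ} (hρ : ρ ∈ Set.Ico (0 : ℝ) 1) (c : ℝ) :
    (prodBernoulli (prm k ρ c)).real {S | IsPivotal ((cfg k) ⁻¹' Aloc m F η) (t, d, (2 : Fin 3)) S} ≤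
      2 ^ k / (1 - ρ) * ∑ j ∈ Finset.range k,
        (M k ρ c).real {ω | IsPivotal (Aloc m F η) (edgeOf (w j, d)) ω} := by
  classical
  set μ := prodBernoulli (prm k ρ c) with hμ
  haveI : IsProbabilityMeasure μ := by rw [hμ]; infer_instance
  set E : Set (Set (Site 2 × Fin 2 × Fin 3)) := (cfg k) ⁻¹' Aloc m F η with hE
  set own : ℕ → Site 2 × Fin 2 × Fin 3 := fun l => (w l, d, (0 : Fin 3)) with hown
  set O : Finset (Site 2 × Fin 2 × Fin 3) := (Finset.range k).image own with hO
  set T : Finset (Site 2 × Fin 2 × Fin 3) := insert (t, d, (2 : Fin 3)) O with hT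
  set Jn : ℕ → Finset (Site 2 × Fin 2 × Fin 3) := fun n => (Finset.range n).image own with hJn
  set g : ℕ → Set (Site 2 × Fin 2 × Fin 3) → Set (Site 2 × Fin 2 × Fin 3) :=
    fun n S => S \ ↑T ∪ ↑(Jn n) with hg
  set X : ℕ → Set (Set (Site 2 × Fin 2 × Fin 3)) := fun n => {S | IsPivotal E (own n) (g n S)} with hX
  set Pv : ℕ → ℝ := fun n => (M k ρ c).real {ω | IsPivotal (Aloc m F η) (edgeOf (w n, d)) ω} with hPv
  have hEm : MeasurableSet E := measurable_cfg k (measurableSet_Aloc m F hη)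
  have h1ρ : 0 < 1 - ρ := by linarith [hρ.2]
  have hρ' : ρ ∈ Set.Icc (0 : ℝ) 1 := Set.Ico_subset_Icc_self hρ
  have hO2 : ∀ x ∈ O, x.2.2 = 0 := by
    intro x hx
    obtain ⟨l, -, rfl⟩ := Finset.mem_image.1 hx
    rfl
  have hiO : ((t, d, (2 : Fin 3)) : Site 2 × Fin 2 × Fin 3) ∉ O := fun h => by
    simpa using hO2 _ h
  have hJnO : ∀ n, n ≤ k → Jn n ⊆ O := fun n hn =>
    Finset.image_subset_image (Finset.range_subset_range.2 hn)
  -- the covering by the chain events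
  have hcover : {S | IsPivotal E (t, d, (2 : Fin 3)) S} ⊆ ⋃ n ∈ Finset.range k, X n := by
    intro S hS
    obtain ⟨n, hn, hpn⟩ := exists_isPivotal_own_of_isPivotal_selector k m F η t d w hw₁ hw₂ hw₃ S hS
    exact Set.mem_biUnion (Finset.mem_range.2 hn) hpn
  -- each chain event is charged to its sub-edge
  have hpiece : ∀ n ∈ Finset.range k, μ.real (X n) ≤ 2 ^ k / (1 - ρ) * Pv n := by
    intro n hn
    rw [Finset.mem_range] at hn
    set C : Set (Set (Site 2 × Fin 2 × Fin 3)) := localCylinder (↑T : Set _) ↑(Jn n) with hC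
    have hCdet : DeterminedBy C (↑T : Set (Site 2 × Fin 2 × Fin 3)) := by
      rw [determinedBy_iff]
      intro S₁ S₂ h
      have h' : ∀ x ∈ T, (x ∈ S₁ ↔ x ∈ S₂) := fun x hx =>
        ⟨fun h₁ => ((Set.ext_iff.1 h x).1 ⟨h₁, hx⟩).1, fun h₂ => ((Set.ext_iff.1 h x).2 ⟨h₂, hx⟩).1⟩
      simp only [hC, localCylinder, Set.mem_setOf_eq]
      exact forall₂_congr fun x hx => by rw [h' x hx]
    have hXdet : DeterminedBy (X n) (↑T : Set (Site 2 × Fin 2 × Fin 3))ᶜ := by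
      rw [determinedBy_iff]
      intro S₁ S₂ h
      have h' : g n S₁ = g n S₂ := by
        simp only [hg, Set.sdiff_eq]
        rw [h]
      simp only [hX, Set.mem_setOf_eq, h']
    have hgm : Measurable (g n) :=
      measurable_set_iff.2 fun x => ((measurable_set_mem x).and measurable_const).or measurable_const
    have hXm : MeasurableSet (X n) := hgm (measurableSet_setOf_isPivotal hEm (own n))
    have hCm : MeasurableSet C := measurableSet_localCylinder T.countable_toSet _
    have hind : μ.real (C ∩ X n) = μ.real C * μ.real (X n) :=
      prodBernoulli_real_inter_of_determinedBy _ T hCdet hXdet hCm hXm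
    -- the weight of the cylinder
    have hCval : (1 - ρ) * (1 / 2) ^ k ≤ μ.real C := by
      rw [hC, hμ, prodBernoulli_real_localCylinder, hT, Finset.prod_insert hiO]
      have hsel : ((t, d, (2 : Fin 3)) : Site 2 × Fin 2 × Fin 3) ∉ (↑(Jn n) : Set _) :=
        fun h => hiO (hJnO n hn.le h)
      have hp2 : (prm k ρ c (t, d, (2 : Fin 3)) : ℝ) = ρ := by
        simp [prm, Set.projIcc_of_mem _ hρ']
      have hcard : O.card ≤ k := Finset.card_image_le.trans (by simp)
      rw [if_neg hsel, hp2]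
      refine mul_le_mul_of_nonneg_left ?_ h1ρ.le
      refine (pow_le_pow_of_le_one (by norm_num) (by norm_num) hcard).trans (le_of_eq ?_)
      rw [← Finset.prod_const]
      refine Finset.prod_congr rfl fun x hx => ?_
      obtain ⟨l, hl, rfl⟩ := Finset.mem_image.1 hx
      have hax := (hw₁ l (Finset.mem_range.1 hl)).1
      have hval : (prm k ρ c (own l) : ℝ) = 1 / 2 := by
        simp [hown, prm, hax]
      rw [hval]
      split_ifs <;> norm_num
    -- on the cylinder the chain sample is the sample itself, with the selector off
    have hsub : C ∩ X n ⊆ (cfg k) ⁻¹' {ω | IsPivotal (Aloc m F η) (edgeOf (w n, d)) ω} := by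
      rintro S ⟨hSC, hSX⟩
      have hTS : ∀ x ∈ T, (x ∈ S ↔ x ∈ Jn n) := fun x hx => by
        simpa using hSC x (Finset.mem_coe.2 hx)
      have hgS : g n S = S := by
        ext x
        by_cases hxT : x ∈ T
        · have hx := hTS x hxT
          simp only [hg, Set.mem_union, Set.mem_sdiff, Finset.mem_coe, hxT, not_true_eq_false,
            and_false, false_or, hx]
        · have hxJ : x ∉ Jn n := fun h => hxT (Finset.mem_insert_of_mem (hJnO n hn.le h))
          simp only [hg, Set.mem_union, Set.mem_sdiff, Finset.mem_coe, hxT, not_false_eq_true,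
            and_true, hxJ, or_false]
      have hselS : (tb k (w n, d), d, (2 : Fin 3)) ∉ S := by
        rw [(hw₁ n hn).2]
        intro h
        exact hiO (hJnO n hn.le ((hTS _ (Finset.mem_insert_self _ _)).1 h))
      have hpivS : IsPivotal E (own n) S := by
        have h := hSX
        simp only [hX, Set.mem_setOf_eq, hgS] at h
        exact h
      exact (isPivotal_own_iff_of_selector_notMem k m F η S hselS).1 hpivS
    have hM : μ.real ((cfg k) ⁻¹' {ω | IsPivotal (Aloc m F η) (edgeOf (w n, d)) ω}) = Pv n := by
      show μ.real _ = (M k ρ c).real {ω | IsPivotal (Aloc m F η) (edgeOf (w n, d)) ω}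
      rw [hμ]
      exact (map_measureReal_apply (measurable_cfg k)
        (measurableSet_setOf_isPivotal (measurableSet_Aloc m F hη) _)).symm
    have hle : μ.real C * μ.real (X n) ≤ Pv n := by
      rw [← hind, ← hM]
      exact measureReal_mono hsub
    have hpos : 0 < (1 - ρ) * (1 / 2 : ℝ) ^ k := by positivity
    have hXn : 0 ≤ μ.real (X n) := measureReal_nonneg
    have hkey : μ.real (X n) * ((1 - ρ) * (1 / 2) ^ k) ≤ Pv n := by
      calc μ.real (X n) * ((1 - ρ) * (1 / 2) ^ k) ≤ μ.real (X n) * μ.real C := by gcongr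
        _ = μ.real C * μ.real (X n) := mul_comm _ _
        _ ≤ Pv n := hle
    rw [← le_div_iff₀ hpos] at hkey
    refine hkey.trans (le_of_eq ?_)
    rw [one_div, inv_pow]
    field_simp
  calc μ.real {S | IsPivotal E (t, d, (2 : Fin 3)) S}
      ≤ μ.real (⋃ n ∈ Finset.range k, X n) := measureReal_mono hcover (measure_ne_top μ _)
    _ ≤ ∑ n ∈ Finset.range k, μ.real (X n) := measureReal_biUnion_finset_le _ _
    _ ≤ ∑ n ∈ Finset.range k, 2 ^ k / (1 - ρ) * Pv n := Finset.sum_le_sum hpiece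
    _ = 2 ^ k / (1 - ρ) * ∑ n ∈ Finset.range k, Pv n := by rw [Finset.mul_sum]

/-! ## The bound on `|∂ρP|` -/

/-- **Stage A, sharp form.** For `0 < k`, `η ≠ 0`, `0 ≤ ρ < 1`, any `c`, and the Finset `W` of
AXIAL window edges: `|∂ρP(ρ,c)| ≤ 2^k/(1-ρ) · Σ_{e ∈ W} M_k(ρ,c)(e pivotal for Aloc)`. -/
theorem abs_Drho_le_sum_axial_pivotal (k m : ℕ) (hk : 0 < k) (F : Fin m → Quad (Set.univ : Set ℂ))
    {η : ℝ} (hη : η ≠ 0) {ρ : ℝ} (hρ : ρ ∈ Set.Ico (0 : ℝ) 1) (c : ℝ) (W : Finset (Sym2 (Site 2)))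
    (hW : ∀ e, e ∈ W ↔ e ∈ window m F η ∧ ∃ (v : Site 2) (d : Fin 2), e = edgeOf (v, d) ∧ ax k (v, d)) :
    |Dρ k m F η (ρ, c)| ≤
      2 ^ k / (1 - ρ) * ∑ e ∈ W, (M k ρ c).real {ω | IsPivotal (Aloc m F η) e ω} := by
  classical
  obtain ⟨K, hK⟩ := exists_coinFinset k m F hη
  have hρ' : ρ ∈ Set.Icc (0 : ℝ) 1 := Set.Ico_subset_Icc_self hρ
  rw [stub_Drho_eq_signed_sum k m F hη hρ' c K hK]
  choose w hw₁ hw₂ hw₃ using fun (t : Site 2) (d : Fin 2) => exists_bundle_param hk t d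
  set μ := prodBernoulli (prm k ρ c) with hμ
  set E : Set (Set (Site 2 × Fin 2 × Fin 3)) := (cfg k) ⁻¹' Aloc m F η with hE
  set Pv : Sym2 (Site 2) → ℝ := fun e => (M k ρ c).real {ω | IsPivotal (Aloc m F η) e ω} with hPv
  have hEm : MeasurableSet E := measurable_cfg k (measurableSet_Aloc m F hη)
  have hPv0 : ∀ e, 0 ≤ Pv e := fun e => measureReal_nonneg
  have hC0 : 0 ≤ (2 : ℝ) ^ k / (1 - ρ) := div_nonneg (by positivity) (by linarith [hρ.2])
  set Ksel := K.filter (fun i : Site 2 × Fin 2 × Fin 3 => i.2.2 = 2) with hKsel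
  -- each selector term
  have hterm : ∀ i ∈ Ksel,
      |μ.real {S | insert i S ∈ E} - μ.real {S | S \ {i} ∈ E}| ≤
        2 ^ k / (1 - ρ) * ∑ j ∈ Finset.range k, Pv (edgeOf (w i.1 i.2.1 j, i.2.1)) := by
    rintro ⟨t, d, l⟩ hi
    simp only [hKsel, Finset.mem_filter] at hi
    obtain ⟨-, rfl⟩ := hi
    exact (abs_real_insert_sub_sdiff_le μ hEm _).trans
      (real_isPivotal_selector_le k m F hη (hw₁ t d) (hw₂ t d) (hw₃ t d) hρ c)
  -- re-indexing the sub-edges by the axial window edges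
  set gg : (Site 2 × Fin 2 × Fin 3) × ℕ → Sym2 (Site 2) :=
    fun x => edgeOf (w x.1.1 x.1.2.1 x.2, x.1.2.1) with hgg
  set D := Ksel ×ˢ Finset.range k with hD
  have hzero : ∀ x ∈ D, gg x ∉ W → Pv (gg x) = 0 := by
    intro x hx hxW
    have hj : x.2 < k := Finset.mem_range.1 (Finset.mem_product.1 hx).2
    have hxw : gg x ∉ window m F η := fun h =>
      hxW ((hW _).2 ⟨h, _, _, rfl, (hw₁ x.1.1 x.1.2.1 x.2 hj).1⟩)
    have hempty : {ω | IsPivotal (Aloc m F η) (gg x) ω} = (∅ : Set (BondConfig (Site 2))) :=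
      Set.eq_empty_of_forall_notMem fun ω => not_isPivotal_Aloc_of_notMem_window m F η hxw ω
    simp only [hPv, hempty, measureReal_empty]
  have hinj : Set.InjOn gg ↑(D.filter fun x => gg x ∈ W) := by
    rintro ⟨⟨t, d, l⟩, j⟩ hx ⟨⟨t', d', l'⟩, j'⟩ hy hxy
    simp only [Finset.coe_filter, hD, hKsel, Set.mem_setOf_eq, Finset.mem_product,
      Finset.mem_filter, Finset.mem_range] at hx hy
    have h := edgeOf_injective hxy
    simp only [Prod.mk.injEq] at h
    obtain ⟨hv, rfl⟩ := h
    have ht : t = t' := by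
      rw [← (hw₁ t d j hx.1.2).2, ← (hw₁ t' d j' hy.1.2).2, hv]
    subst ht
    have hj : j = j' := hw₃ t d j j' hx.1.2 hy.1.2 hv
    subst hj
    rw [hx.1.1.2, hy.1.1.2]
  have hreindex : ∑ i ∈ Ksel, ∑ j ∈ Finset.range k, Pv (edgeOf (w i.1 i.2.1 j, i.2.1)) ≤
      ∑ e ∈ W, Pv e := by
    rw [← Finset.sum_product']
    calc ∑ x ∈ D, Pv (gg x) = ∑ x ∈ D.filter (fun x => gg x ∈ W), Pv (gg x) := by
          rw [Finset.sum_filter]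
          refine Finset.sum_congr rfl fun x hx => ?_
          split_ifs with h
          · rfl
          · exact hzero x hx h
      _ = ∑ e ∈ (D.filter fun x => gg x ∈ W).image gg, Pv e := (Finset.sum_image hinj).symm
      _ ≤ ∑ e ∈ W, Pv e := by
          refine Finset.sum_le_sum_of_subset_of_nonneg (fun e he => ?_) fun e _ _ => hPv0 e
          obtain ⟨x, hx, rfl⟩ := Finset.mem_image.1 he
          exact (Finset.mem_filter.1 hx).2
  calc |∑ i ∈ Ksel, (μ.real {S | insert i S ∈ E} - μ.real {S | S \ {i} ∈ E})|
      ≤ ∑ i ∈ Ksel, |μ.real {S | insert i S ∈ E} - μ.real {S | S \ {i} ∈ E}| :=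
        Finset.abs_sum_le_sum_abs _ _
    _ ≤ ∑ i ∈ Ksel, 2 ^ k / (1 - ρ) * ∑ j ∈ Finset.range k, Pv (edgeOf (w i.1 i.2.1 j, i.2.1)) :=
        Finset.sum_le_sum hterm
    _ = 2 ^ k / (1 - ρ) * ∑ i ∈ Ksel, ∑ j ∈ Finset.range k, Pv (edgeOf (w i.1 i.2.1 j, i.2.1)) := by
        rw [Finset.mul_sum]
    _ ≤ 2 ^ k / (1 - ρ) * ∑ e ∈ W, Pv e := mul_le_mul_of_nonneg_left hreindex hC0

/-- **STAGE A of `stub_slopeBounds`** (registered sub-goal `Drho_abs_le_sum_axial_pivotal`): for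
`0 < k`, `η ≠ 0`, `δ > 0`, `ρ ∈ [0, 1-δ]`, every `c`, and the Finset `W` of axial window edges,
`|∂ρP(ρ,c)| ≤ (2^k/δ) · Σ_{e ∈ W} M_k(ρ,c)(e pivotal for Aloc)` — the `ρ`-derivative is dominated,
uniformly in the mesh, by the expected number of AXIAL pivotal edges. -/
theorem Drho_abs_le_sum_axial_pivotal :
    ∀ k : ℕ, 0 < k → ∀ (m : ℕ) (F : Fin m → Quad (Set.univ : Set ℂ)), ∀ {η : ℝ}, η ≠ 0 → ∀ δ : ℝ, 0 < δ → ∀ ρ ∈ Set.Icc (0 : ℝ) (1 - δ), ∀ (c : ℝ) (W : Finset (Sym2 (Site 2))), (∀ e, e ∈ W ↔ e ∈ window m F η ∧ ∃ (v : Site 2) (d : Fin 2), e = edgeOf (v, d) ∧ ax k (v, d)) → |Dρ k m F η (ρ, c)| ≤ (2 ^ k / δ) * ∑ e ∈ W, (M k ρ c).real {ω | IsPivotal (Aloc m F η) e ω} := by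
  intro k hk m F η hη δ hδ ρ hρ c W hW
  have hρ' : ρ ∈ Set.Ico (0 : ℝ) 1 := ⟨hρ.1, by linarith [hρ.2]⟩
  refine (abs_Drho_le_sum_axial_pivotal k m hk F hη hρ' c W hW).trans ?_
  refine mul_le_mul_of_nonneg_right ?_ (Finset.sum_nonneg fun e _ => measureReal_nonneg)
  exact div_le_div_of_nonneg_left (by positivity) hδ (by linarith [hρ.2])

end Summit.CriticalPhenomena.CardyFormulaZ2.Theorems.CardySelfRefinement

end
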